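import Literature.NumberTheory.Automorphic.Liu2021.LemD1AsPrintedIndexedNonVacuityLevelTwist
import Literature.NumberTheory.Automorphic.Liu2021.LemD1AsPrintedIndexedNonVacuityTameTwistCM
import HarnessLib

/-!
# [Liu2021, Def. 4.1 ∕ 4.11, App. D §D.1 Step 2, Lemma D.1 (3)] — the LEVEL TWIST GLOBALISED: two members of the displayed `hD3`
# family (conjugate symplectic `ψ`, `ψ'` of the SAME ∞-type) with DIFFERENT μ-labels at a PRESCRIBED finite place `v` of `L⁺` —
# EVERY `v`, the places above `2` included

Reproduction ∕ bookkeeping (Literature, THEOREMS ONLY: no definition, no record, no named fact, no `sorry`; nothing is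
asserted about Liu's oscillator representations or about the tree's constructed local Weil carriers).

Sequel of `LemD1AsPrintedIndexedNonVacuityLevelTwist.lean` (the LEVEL character `θ_w` of `E_wˣ` at ANY place: finite order, open
kernel, `θ_w(−1) ≠ 1`) and of `LemD1AsPrintedIndexedNonVacuityTameTwistCM.lean` (the globalisation machinery: `ψ' = ψ · θ̃ · (θ̃ ∘ c)⁻¹`
for a finite-order Hecke character `θ`, `exists_twist_of_isFiniteOrder`; the local effect of the twist, `localMu_mul_twist_apply` ∕
`localMu_mul_twist_apply_single`; the SYNTHESIS `exists_isConjugateSymplectic_localMu_ne` at every place `v ∤ 2`).  Every statement of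
the latter carried `2 ∉ v` only because the prescribed local component came from the TAME character; with the level character the same
proofs run at EVERY place:

* §1 **`exists_heckeCharacter_isFiniteOrder_level`** ([ClozelHarrisTaylor2008, Lem. 4.1.1] «there is a continuous character
  `χ : Fˣ\\𝔸_Fˣ → ℚ̄ˣ` such that `χ|_{∏_{v∈S} F_vˣ} = χ_S`», tree `exists_heckeCharacter_isFiniteOrder_localComponent_eq`, at `S = {w}`):
  at ANY place `w` of `L` a Hecke character `θ` of FINITE ORDER with `θ_w` trivial on `1 + 2𝔭_w` and `θ_w(−1) = −1`;
  **`exists_heckeCharacter_isFiniteOrder_level_and_trivial`**: the same with `θ_{w'} = 1` at a second place `w' ≠ w` (`S = {w, w'}`).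
* §2 **`exists_isConjugateSymplectic_localMu_apply_eps_eq_neg`** (ANY `v`, `w ∣ v` fixed by `c`): for every conjugate symplectic `ψ` of
  ∞-type `e` a conjugate symplectic `ψ'` of ∞-type `e` with `localMu L (toHeckeCharacter L ψ') v (ε) = −localMu L (toHeckeCharacter L ψ) v (ε)`;
  **`exists_isConjugateSymplectic_localMu_apply_single_eq_neg_of_split`** (ANY `v`, `c • w ≠ w`): value `−(label of ψ)` at the unit
  `(−1 at w, 1 at c w)`; SYNTHESIS **`exists_isConjugateSymplectic_localMu_ne`**: at EVERY finite place `v` of `L⁺` every conjugate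
  symplectic `ψ` has a same-∞-type companion with a DIFFERENT μ-label at `v` — `…TameTwistCM`'s synthesis with its exceptional set (the
  places above `2`) REMOVED; weight ∕ CM-type ∕ packaged-`muOf` forms; `forall_exists_isConjugateSymplectic_localMu_ne` (the `∀ v` form).

What this does NOT give: simultaneous control at several prescribed places beyond the two of §1 (CHT 4.1.1 allows any finite `S`; not
spelled out); which companion is unramified where (at a dyadic `w` the level character is wild, so `ψ'` ramifies above `v`); anything
about the rows' carriers `𝓢.omegaLoc v` or `χ_v`; Lem. D.1 itself.  HC_CM is NOT proved.

Cell pub-hodgecm2 (COR-CM), audit class of the END rows `hD1''` ∕ `hD3`; seat prover-pub-hodgecm2-b10.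

References: [Liu2021] Y. Liu, *Fourier–Jacobi cycles and arithmetic relative trace formula*, Camb. J. Math. 9 (2021) =
arXiv:2102.11518, §4.1 Def. 4.1 (`FJcycle.tex` l. 1900–1902), after Remark 4.2 (l. 1912, «`μ^c ≔ μ ∘ c`»), Def. 4.3, Def. 4.11
(l. 2086), App. D §D.1 Steps 1–2 (l. 5217–5219), Lemma D.1 (3) (l. 5233); [ClozelHarrisTaylor2008] L. Clozel, M. Harris, R. Taylor,
Publ. Math. IHÉS 108 (2008), Lemma 4.1.1 (p. 116); [NeukirchANT1999] J. Neukirch, *Algebraic Number Theory* (1999), Ch. II §3 (higher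
unit groups) with Prop. (3.10), Ch. VII §6 (6.9) (characters of finite order); [CasselsFrohlichANT1967] Ch. II §10, Ch. VII §1.1 (the
Galois action on completions and local idèles).
-/

noncomputable section

open scoped Matrix MatrixGroups
open NumberField IsDedekindDomain
open Literature.NumberTheory.GaloisRepresentations (HeckeCharacter ideleGroup localUnits infiniteIdeles)
open Literature.NumberTheory.Automorphic.IdeleClassGroup (toHeckeCharacter isUnitary_toHeckeCharacter IsConjugateSymplectic
  HasInfinityType HasWeight HasCMType galConj)

namespace Literature.NumberTheory.Automorphic.Liu2021.LemD1IndexedNonVacuityLevelTwistCM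

open UnitaryGroup
open LemD1IndexedNonVacuityTameTwistCM (exists_twist_of_isFiniteOrder localMu_mul_twist_apply localMu_mul_twist_apply_single)

variable (L : Type) [Field L] [NumberField L] [IsCMField L]

local notation3 "cc" => (IsCMField.complexConj L)
local notation3 "L⁺" => (↥(maximalRealSubfield L))

/-! ## §1 A finite-order Hecke character of `L` whose component at a prescribed place `w` — ANY `w` — is the LEVEL character -/

omit [IsCMField L] in
/-- **globalisation of the level character** ([ClozelHarrisTaylor2008, Lem. 4.1.1] in the tree's idelic form, at `S = {w}`): at ANY finite
place `w` of `L` there is a Hecke character `θ` of `L` of FINITE ORDER whose local component `θ_w` is trivial on `1 + 2𝔭_w = {x : v_w(x−1) < v_w(2)}`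
and has `θ_w(−1) = −1`.  (`…TameTwistCM.exists_heckeCharacter_isFiniteOrder_tame` needed `w ∤ 2`.)
[cite: ClozelHarrisTaylor2008, Lemma 4.1.1 (p. 116)] [cite: NeukirchANT1999, Ch. II §3 Prop. (3.10)] -/
theorem exists_heckeCharacter_isFiniteOrder_level (w : HeightOneSpectrum (𝓞 L)) :
    ∃ θ : HeckeCharacter L, θ.IsFiniteOrder ∧
      (∀ x : (w.adicCompletion L)ˣ,
        Valued.v ((x : w.adicCompletion L) - 1) < Valued.v (2 : w.adicCompletion L) → θ.localComponent w x = 1) ∧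
      θ.localComponent w (-1) = -1 := by
  classical
  obtain ⟨θw, hopen, hfin, -, hlevel, hneg⟩ := LemD1IndexedNonVacuityLevelTwist.exists_level_character w
  obtain ⟨θ, hθfin, hθw⟩ :=
    GaloisRepresentations.ClozelHarrisTaylor2008.exists_heckeCharacter_isFiniteOrder_localComponent_eq {w}
      (Function.update (fun w' : HeightOneSpectrum (𝓞 L) => (1 : (w'.adicCompletion L)ˣ →* ℂˣ)) w θw) (fun v hv => by
        rw [Finset.mem_singleton] at hv
        subst hv
        rw [Function.update_self]
        exact ⟨hopen, hfin⟩)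
  have hw : θ.localComponent w = θw := by rw [hθw w (Finset.mem_singleton_self w), Function.update_self]
  have hsq : θw (-1) = -1 := by
    have h1 : θw (-1) ^ 2 = 1 := by rw [← map_pow, neg_one_sq, map_one]
    have h2' : (((θw (-1) : ℂˣ) : ℂ)) ^ 2 = 1 := by rw [← Units.val_pow_eq_pow_val, h1, Units.val_one]
    rcases sq_eq_one_iff.1 h2' with h | h
    · exact absurd (Units.ext h) hneg
    · exact Units.ext (by rw [h, Units.val_neg, Units.val_one])
  exact ⟨θ, hθfin, fun x hx => by rw [hw]; exact hlevel x hx, by rw [hw]; exact hsq⟩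

omit [IsCMField L] in
/-- **a finite-order Hecke character with prescribed components at TWO places**: the level character at ANY `w` (`θ_w(−1) = −1`) and
TRIVIAL at a second place `w' ≠ w` ([ClozelHarrisTaylor2008, Lem. 4.1.1] at `S = {w, w'}`). [cite: ClozelHarrisTaylor2008, Lemma 4.1.1 (p. 116)] -/
theorem exists_heckeCharacter_isFiniteOrder_level_and_trivial (w w' : HeightOneSpectrum (𝓞 L)) (hww' : w' ≠ w) :
    ∃ θ : HeckeCharacter L, θ.IsFiniteOrder ∧ θ.localComponent w (-1) = -1 ∧ θ.localComponent w' = 1 := by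
  classical
  obtain ⟨θw, hopen, hfin, -, -, hneg⟩ := LemD1IndexedNonVacuityLevelTwist.exists_level_character w
  obtain ⟨θ, hθfin, hθw⟩ :=
    GaloisRepresentations.ClozelHarrisTaylor2008.exists_heckeCharacter_isFiniteOrder_localComponent_eq {w, w'}
      (Function.update (fun w'' : HeightOneSpectrum (𝓞 L) => (1 : (w''.adicCompletion L)ˣ →* ℂˣ)) w θw) (fun u hu => by
        rw [Finset.mem_insert, Finset.mem_singleton] at hu
        rcases hu with rfl | rfl
        · rw [Function.update_self]; exact ⟨hopen, hfin⟩
        · rw [Function.update_of_ne hww']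
          exact ⟨by rw [MonoidHom.ker_one]; exact isOpen_univ, IsOfFinOrder.one⟩)
  have hw : θ.localComponent w = θw := by
    rw [hθw w (Finset.mem_insert_self _ _), Function.update_self]
  have hw' : θ.localComponent w' = 1 := by
    rw [hθw w' (Finset.mem_insert_of_mem (Finset.mem_singleton_self _)), Function.update_of_ne hww']
  have hsq : θw (-1) = -1 := by
    have h1 : θw (-1) ^ 2 = 1 := by rw [← map_pow, neg_one_sq, map_one]
    have h2' : (((θw (-1) : ℂˣ) : ℂ)) ^ 2 = 1 := by rw [← Units.val_pow_eq_pow_val, h1, Units.val_one]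
    rcases sq_eq_one_iff.1 h2' with h | h
    · exact absurd (Units.ext h) hneg
    · exact Units.ext (by rw [h, Units.val_neg, Units.val_one])
  exact ⟨θ, hθfin, by rw [hw]; exact hsq, hw'⟩

/-! ## §2 Two members of the displayed `hD3` family with DIFFERENT μ-labels at a PRESCRIBED place `v` of `L⁺` — ANY `v` -/

open Literature.NumberTheory.GelbartRogawski1991.UnitaryDualPair (imagUnit complexConj_imagUnit imagUnit_ne_zero)
open Literature.NumberTheory.GelbartRogawski1991.UnitaryDualPair.LocalSplitting (localMu localMu_apply norm_localMu
  continuous_localMu localMu_toLocalRing_eq_one_iff)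
open Literature.RepresentationTheory.Liu2021 (isOscillatorChar_toHeckeCharacter_iff)

variable (v : HeightOneSpectrum (𝓞 (maximalRealSubfield L)))

/-- the `w`-component of `ε = δ ⊗ 1` times the inverse of its `c_w`-conjugate is `−1` (`c δ = −δ`, `c_w` extends `c`; copy of the private
lemma of `…TameTwistCM`). [cite: Liu2021, App. D §D.1 Step 1 (l. 5217)] [cite: CasselsFrohlichANT1967, Ch. VII §1.1] -/
private theorem eval_eps_mul_inv_conj (w : PlacesOver L v) (hw : cc • w.1 = w.1) :
    Units.map (Pi.evalMonoidHom (fun w : PlacesOver L v => w.1.adicCompletion L) w) (LemD1OfPlace.eps L v (imagUnit_ne_zero L)) *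
        (galAdicCompletionUnitsEquiv (L := L) cc hw
          (Units.map (Pi.evalMonoidHom (fun w : PlacesOver L v => w.1.adicCompletion L) w)
            (LemD1OfPlace.eps L v (imagUnit_ne_zero L))))⁻¹ = -1 := by
  rw [mul_inv_eq_iff_eq_mul, neg_one_mul]
  apply Units.ext
  rw [Units.val_neg]
  change ((imagUnit L : L) : w.1.adicCompletion L) =
    -galAdicCompletionMap cc hw ((imagUnit L : L) : w.1.adicCompletion L)
  rw [galAdicCompletionMap_coe, AlgEquiv.smul_def, complexConj_imagUnit]
  have hc : ∀ x : L, ((x : L) : w.1.adicCompletion L) = algebraMap L (w.1.adicCompletion L) x := fun x => by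
    rw [HeightOneSpectrum.algebraMap_adicCompletion]; rfl
  rw [hc, hc, map_neg, neg_neg]

/-- **MAIN at a NON-SPLIT place — ANY `v`**: for `w ∣ v` fixed by complex conjugation and a conjugate symplectic `ψ` ([Liu2021, Def. 4.1])
of ∞-type `e`, there is a conjugate symplectic `ψ'` of ∞-type `e` with `localMu L (toHeckeCharacter L ψ') v (ε) = −localMu L (toHeckeCharacter L ψ) v (ε)`
at `ε = δ ⊗ 1` — hence different μ-labels at `v` (`ψ' = ψ · θ̃ · (θ̃ ∘ c)⁻¹` for the finite-order `θ` of §1; at `ε` the twist contributes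
`θ_w(ε_w (c_w ε_w)⁻¹) = θ_w(−1) = −1`).  `…TameTwistCM.exists_isConjugateSymplectic_localMu_apply_eps_eq_neg` without its hypothesis `2 ∉ v`.
[cite: Liu2021, App. D §D.1 Step 2 (l. 5219), Def. 4.1 (l. 1900–1902), Def. 4.11 (l. 2086)] [cite: ClozelHarrisTaylor2008, Lemma 4.1.1 (p. 116)] -/
theorem exists_isConjugateSymplectic_localMu_apply_eps_eq_neg (w : PlacesOver L v) (hw : cc • w.1 = w.1)
    (ψ : IdeleClassGroup L →ₜ* Circle) (hψ : IsConjugateSymplectic L ψ) {e : InfinitePlace L → ℤ} (he : HasInfinityType L ψ e) :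
    ∃ ψ' : IdeleClassGroup L →ₜ* Circle, IsConjugateSymplectic L ψ' ∧ HasInfinityType L ψ' e ∧
      localMu L (toHeckeCharacter L ψ') v (LemD1OfPlace.eps L v (imagUnit_ne_zero L)) =
        -localMu L (toHeckeCharacter L ψ) v (LemD1OfPlace.eps L v (imagUnit_ne_zero L)) ∧
      localMu L (toHeckeCharacter L ψ') v ≠ localMu L (toHeckeCharacter L ψ) v := by
  obtain ⟨θ, hθfin, -, hθneg⟩ := exists_heckeCharacter_isFiniteOrder_level L w.1
  obtain ⟨ψ', hψ', he', hH⟩ := exists_twist_of_isFiniteOrder L hθfin ψ hψ he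
  have key : localMu L (toHeckeCharacter L ψ') v (LemD1OfPlace.eps L v (imagUnit_ne_zero L)) =
      -localMu L (toHeckeCharacter L ψ) v (LemD1OfPlace.eps L v (imagUnit_ne_zero L)) := by
    rw [hH, localMu_mul_twist_apply L v _ θ w hw, eval_eps_mul_inv_conj L v w hw, hθneg, mul_neg, mul_one]
  refine ⟨ψ', hψ', he', key, fun h => ?_⟩
  rw [h] at key
  have := Units.ext_iff.1 key
  rw [Units.val_neg] at this
  exact (localMu L (toHeckeCharacter L ψ) v (LemD1OfPlace.eps L v (imagUnit_ne_zero L))).ne_zero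
    (by linear_combination (1 : ℂ) / 2 * this)

open scoped Classical in
/-- **MAIN at a SPLIT place — ANY `v`**: for `w ∣ v` with `c • w ≠ w` and a conjugate symplectic `ψ` of ∞-type `e`, there is a conjugate
symplectic `ψ'` of ∞-type `e` whose μ-label at `v` takes the value `−(μ-label of ψ)` at the unit `z = (−1 at w, 1 at c w)` of `L_v`
(`ψ' = ψ · θ̃ · (θ̃ ∘ c)⁻¹` for the finite-order `θ` with `θ_w` the level character and `θ_{c w} = 1`); in particular the two labels DIFFER.
`…TameTwistCM.exists_isConjugateSymplectic_localMu_apply_single_eq_neg_of_split` without `2 ∉ v`.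
[cite: Liu2021, App. D §D.1 Step 2 (l. 5219), Def. 4.1 (l. 1900–1902), Def. 4.11 (l. 2086)] [cite: ClozelHarrisTaylor2008, Lemma 4.1.1 (p. 116)] -/
theorem exists_isConjugateSymplectic_localMu_apply_single_eq_neg_of_split (w : PlacesOver L v) (hw : cc • w.1 ≠ w.1)
    (ψ : IdeleClassGroup L →ₜ* Circle) (hψ : IsConjugateSymplectic L ψ) {e : InfinitePlace L → ℤ} (he : HasInfinityType L ψ e) :
    ∃ ψ' : IdeleClassGroup L →ₜ* Circle, IsConjugateSymplectic L ψ' ∧ HasInfinityType L ψ' e ∧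
      localMu L (toHeckeCharacter L ψ') v
          (MulEquiv.piUnits.symm (Pi.mulSingle w (-1) : ∀ w' : PlacesOver L v, (w'.1.adicCompletion L)ˣ)) =
        -localMu L (toHeckeCharacter L ψ) v
          (MulEquiv.piUnits.symm (Pi.mulSingle w (-1) : ∀ w' : PlacesOver L v, (w'.1.adicCompletion L)ˣ)) ∧
      localMu L (toHeckeCharacter L ψ') v ≠ localMu L (toHeckeCharacter L ψ) v := by
  classical
  obtain ⟨θ, hθfin, hθneg, hθ'⟩ := exists_heckeCharacter_isFiniteOrder_level_and_trivial L w.1 (cc • w.1) hw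
  obtain ⟨ψ', hψ', he', hH⟩ := exists_twist_of_isFiniteOrder L hθfin ψ hψ he
  have key : localMu L (toHeckeCharacter L ψ') v
        (MulEquiv.piUnits.symm (Pi.mulSingle w (-1) : ∀ w' : PlacesOver L v, (w'.1.adicCompletion L)ˣ)) =
      -localMu L (toHeckeCharacter L ψ) v
        (MulEquiv.piUnits.symm (Pi.mulSingle w (-1) : ∀ w' : PlacesOver L v, (w'.1.adicCompletion L)ˣ)) := by
    rw [hH, localMu_mul_twist_apply_single L v _ θ w, hθneg, hθ', MonoidHom.one_apply, inv_one, mul_one, mul_neg, mul_one]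
  refine ⟨ψ', hψ', he', key, fun h => ?_⟩
  rw [h] at key
  have := Units.ext_iff.1 key
  rw [Units.val_neg] at this
  exact (localMu L (toHeckeCharacter L ψ) v _).ne_zero (by linear_combination (1 : ℂ) / 2 * this)

/-- **SYNTHESIS — at EVERY finite place `v` of `L⁺`, split or not, above `2` or not**: for every conjugate symplectic `ψ` of ∞-type `e`
there is a conjugate symplectic `ψ'` of the SAME ∞-type whose μ-label `localMu L (toHeckeCharacter L ψ') v` differs from that of `ψ`:
the μ-conjunct of the `hD3` row distinguishes two members of the displayed family at EVERY prescribed place (`…TameTwistCM`'s synthesis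
with the exceptional set — the prime factors of `2` — removed). [cite: Liu2021, App. D §D.1 Step 2 (l. 5219), Lemma D.1 (3) (l. 5233), Def. 4.1 (l. 1900–1902)] -/
theorem exists_isConjugateSymplectic_localMu_ne (ψ : IdeleClassGroup L →ₜ* Circle)
    (hψ : IsConjugateSymplectic L ψ) {e : InfinitePlace L → ℤ} (he : HasInfinityType L ψ e) :
    ∃ ψ' : IdeleClassGroup L →ₜ* Circle, IsConjugateSymplectic L ψ' ∧ HasInfinityType L ψ' e ∧
      localMu L (toHeckeCharacter L ψ') v ≠ localMu L (toHeckeCharacter L ψ) v := by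
  obtain ⟨w⟩ := (inferInstance : Nonempty (PlacesOver L v))
  by_cases hw : cc • w.1 = w.1
  · obtain ⟨ψ', hψ', he', -, hne⟩ := exists_isConjugateSymplectic_localMu_apply_eps_eq_neg L v w hw ψ hψ he
    exact ⟨ψ', hψ', he', hne⟩
  · obtain ⟨ψ', hψ', he', -, hne⟩ := exists_isConjugateSymplectic_localMu_apply_single_eq_neg_of_split L v w hw ψ hψ he
    exact ⟨ψ', hψ', he', hne⟩

/-- **the `∀ v` form**: for every conjugate symplectic `ψ` of ∞-type `e` and EVERY finite place `v` of `L⁺` a same-∞-type companion with a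
different μ-label at `v`. [cite: Liu2021, App. D §D.1 Step 2 (l. 5219), Lemma D.1 (3) (l. 5233)] -/
theorem forall_exists_isConjugateSymplectic_localMu_ne (ψ : IdeleClassGroup L →ₜ* Circle)
    (hψ : IsConjugateSymplectic L ψ) {e : InfinitePlace L → ℤ} (he : HasInfinityType L ψ e) :
    ∀ v : HeightOneSpectrum (𝓞 L⁺), ∃ ψ' : IdeleClassGroup L →ₜ* Circle, IsConjugateSymplectic L ψ' ∧ HasInfinityType L ψ' e ∧
      localMu L (toHeckeCharacter L ψ') v ≠ localMu L (toHeckeCharacter L ψ) v :=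
  fun v => exists_isConjugateSymplectic_localMu_ne L v ψ hψ he

/-- **weight form** (the rows: weight one) — ANY `v`. [cite: Liu2021, Def. 4.3; App. D §D.1 Step 2 (l. 5219)] -/
theorem exists_isConjugateSymplectic_hasWeight_localMu_ne (ψ : IdeleClassGroup L →ₜ* Circle) (hψ : IsConjugateSymplectic L ψ)
    {𝔴 : InfinitePlace L → ℕ} (h𝔴 : HasWeight L ψ 𝔴) :
    ∃ ψ' : IdeleClassGroup L →ₜ* Circle, IsConjugateSymplectic L ψ' ∧ HasWeight L ψ' 𝔴 ∧
      localMu L (toHeckeCharacter L ψ') v ≠ localMu L (toHeckeCharacter L ψ) v := by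
  obtain ⟨e, he, rfl⟩ := h𝔴
  obtain ⟨ψ', hψ', he', hne⟩ := exists_isConjugateSymplectic_localMu_ne L v ψ hψ he
  exact ⟨ψ', hψ', ⟨e, he', rfl⟩, hne⟩

/-- **CM-type form** (same CM type `Φ`) — ANY `v`. [cite: Liu2021, Def. 4.3; App. D §D.1 Step 2 (l. 5219)] -/
theorem exists_isConjugateSymplectic_hasCMType_localMu_ne (ψ : IdeleClassGroup L →ₜ* Circle) (hψ : IsConjugateSymplectic L ψ)
    {Φ : Literature.AlgebraicGeometry.Motives.CMType L} (hΦ : HasCMType L ψ Φ) :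
    ∃ ψ' : IdeleClassGroup L →ₜ* Circle, IsConjugateSymplectic L ψ' ∧ HasCMType L ψ' Φ ∧
      localMu L (toHeckeCharacter L ψ') v ≠ localMu L (toHeckeCharacter L ψ) v := by
  obtain ⟨e, hne, he, rfl⟩ := hΦ
  obtain ⟨ψ', hψ', he', hne'⟩ := exists_isConjugateSymplectic_localMu_ne L v ψ hψ he
  exact ⟨ψ', hψ', ⟨e, hne, he', rfl⟩, hne'⟩

/-- **two conjugate symplectic characters of weight one with different μ-labels at `v` exist — ANY `v`** (no input `ψ`; a conjugate
symplectic weight-one `ψ` exists on every CM field, `LemD1IndexedNonVacuityNonsplitPlace.exists_isConjugateSymplectic_hasWeight_one`).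
[cite: Liu2021, Def. 4.1 (l. 1900–1902), Def. 4.3; App. D §D.1 Step 2 (l. 5219)] -/
theorem exists_pair_isConjugateSymplectic_hasWeight_one_localMu_ne :
    ∃ ψ ψ' : IdeleClassGroup L →ₜ* Circle, IsConjugateSymplectic L ψ ∧ HasWeight L ψ 1 ∧ IsConjugateSymplectic L ψ' ∧
      HasWeight L ψ' 1 ∧ localMu L (toHeckeCharacter L ψ') v ≠ localMu L (toHeckeCharacter L ψ) v := by
  obtain ⟨ψ, hψ, hw1⟩ := LemD1IndexedNonVacuityNonsplitPlace.exists_isConjugateSymplectic_hasWeight_one L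
  obtain ⟨ψ', hψ', hw1', hne⟩ := exists_isConjugateSymplectic_hasWeight_localMu_ne L v ψ hψ hw1
  exact ⟨ψ, ψ', hψ, hw1, hψ', hw1', hne⟩

variable (N : ℕ) (J : Matrix (Fin N) (Fin N) L) (hN : 2 ≤ N) (hJh : (J.map (IsCMField.complexConj L))ᵀ = J) (hJdet : J.det ≠ 0)

/-- **the packaged `hD3` labels differ at EVERY prescribed place `v`** (split or not, above `2` or not), for a companion `ψ'` of the same
∞-type: `LemD1OfPlace.muOf (localMu … ψ' …) ≠ LemD1OfPlace.muOf (localMu … ψ …)` with VERBATIM the rows' displayed side proofs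
`norm_localMu` ∕ `continuous_localMu` ∕ `localMu_toLocalRing_eq_one_iff … ((isOscillatorChar_toHeckeCharacter_iff _).mpr _)`.
[cite: Liu2021, App. D §D.1 Step 2 (l. 5219), Lemma D.1 (3) (l. 5233)] -/
theorem exists_isConjugateSymplectic_muOf_localMu_ne (ψ : IdeleClassGroup L →ₜ* Circle)
    (hψ : IsConjugateSymplectic L ψ) {e : InfinitePlace L → ℤ} (he : HasInfinityType L ψ e) :
    ∃ (ψ' : IdeleClassGroup L →ₜ* Circle) (hψ' : IsConjugateSymplectic L ψ'), HasInfinityType L ψ' e ∧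
      LemD1OfPlace.muOf L v cc N J (complexConj_imagUnit L) (imagUnit_ne_zero L) hN hJh hJdet
          (localMu L (toHeckeCharacter L ψ') v)
          (fun x => norm_localMu L (toHeckeCharacter L ψ') v (isUnitary_toHeckeCharacter L ψ') x)
          (continuous_localMu L (toHeckeCharacter L ψ') v)
          (fun t => localMu_toLocalRing_eq_one_iff L (toHeckeCharacter L ψ') v
            ((isOscillatorChar_toHeckeCharacter_iff ψ').mpr hψ') t) ≠
        LemD1OfPlace.muOf L v cc N J (complexConj_imagUnit L) (imagUnit_ne_zero L) hN hJh hJdet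
          (localMu L (toHeckeCharacter L ψ) v)
          (fun x => norm_localMu L (toHeckeCharacter L ψ) v (isUnitary_toHeckeCharacter L ψ) x)
          (continuous_localMu L (toHeckeCharacter L ψ) v)
          (fun t => localMu_toLocalRing_eq_one_iff L (toHeckeCharacter L ψ) v
            ((isOscillatorChar_toHeckeCharacter_iff ψ).mpr hψ) t) := by
  obtain ⟨ψ', hψ', he', hne⟩ := exists_isConjugateSymplectic_localMu_ne L v ψ hψ he
  exact ⟨ψ', hψ', he', fun h => hne (congrArg Subtype.val h)⟩

end Literature.NumberTheory.Automorphic.Liu2021.LemD1IndexedNonVacuityLevelTwistCM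

end
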